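/-
Origin: expansion seat `literature-prover-pub-hodgecm-cf-kudla-howe-rallis-g4-0`, handover #4 2026-08-18T07:30:36Z (`HOME/pub-hodgecm-cf-kudla-howe-rallis-g4/SiegelWeilFromWeil.lean`, md5 3382f98e, 84 lines);
landed by the gen-7 packager in gate run 26 as `HodgeCM/PerL34/SiegelWeilFromWeil.lean` (verbatim).
-/
/-
Origin: HOME/pub-hodgecm-cf-kudla-howe-rallis-g4/SiegelWeilFromWeil.lean — session
literature-prover-pub-hodgecm-cf-kudla-howe-rallis-g4-0 (unit pub-hodgecm-cf-kudla-howe-rallis-g4, CITED-FACT seat (4), gen 4).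
Intended final place: `HodgeCM/PerL34/SiegelWeilFromWeil.lean` (NEW leaf; imports the LANDED
`HodgeCM.PerL34.SiegelWeil` (pv15, run 18/21/22) and `HodgeCM.Literature.ThetaCorrespondence` (cf-KHR); nothing imports it).
-/
import Summits.HodgeConjecture.HodgeCM.PerL34.SiegelWeil_2
import Summits.HodgeConjecture.HodgeCM.Literature.ThetaCorrespondence_4

set_option autoImplicit false

/-!
# The Siegel–Weil input `X1` of node N31d, consumed BY NAME from Weil's Théorème 5 (KHR-8)

pv15's `HodgeCM.PerL34.N31d.DoublingKernelData.PrintInputs.X1_siegelWeil` (PerL v5 tex ll. 573–581: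
`∫_{[G_U]} θ^□_Φ(g,h) dg = c · E(h, s₀; f_Φ)`, `c > 0`) is a labelled PRINT field citing [We65, Théorème 5] / [GQT14,
Thm 7.1].  The theta Literature layer types Weil's theorem verbatim as
`HodgeCM.Literature.Theta.SiegelWeilDatum.WeilSiegelWeil` ([We65, n° 52, pp. 76–77]; KHR-8, run 19), over Weil's
own carriers (`S(X_A)`, `Φ ↦ I_ν(Φ)`, `Φ ↦ E(Φ)`, `m, n, 4ε`, the place/measure hypothesis).  Until now no module
consumed that record by name (the cited-fact census of 2026-08-18T07:2xZ).  This file supplies the BY-NAME link: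
`X1` follows from `WeilSiegelWeil` for a Weil datum `W` plus an explicitly LABELLED dictionary `WeilTransport D W`
whose three fields are exactly the D4 readings already on record (GAPS adv4g4-C12, PerL ll. 584–588; LEMMAS §3 D4):

* `pull Φ h : W.SX` — the Schwartz–Bruhat function `ω̃(s_χ(h)) Φ ∈ S(X_A)` (Kudla's splitting `s_χ`, transport
  along which Weil's identity of functions on `Mp(X)_A` restricts to PerL's identity on `H(𝔸)` — adv4g4-C12 (b));
* `theta_pull` — `∫_{[G_U]} θ^□_Φ(x,h) dμ(x) = c₀ · I_ν(pull Φ h)` with ONE constant `c₀ > 0`: Weil's `I_ν` is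
  taken with `ν(G_A/G_k) = 1` (Thm 5: "Soit ν une mesure positive sur G_A/G_k … telle que ν(G_A/G_k) = 1"), PerL's
  `dg` is any invariant measure on the compact `[G_U]`, so `c₀ = μ([G_U])` (measure normalisation, D4);
* `eis_pull` — `E(h, s₀; f_Φ) = E(pull Φ h)`: PerL's Eisenstein series `Σ_{P(L₀)\H(L₀)} f_Φ(γh)`, `f_Φ(h) =
  (ω^□(h)Φ)(0)`, IS Weil's Eisenstein–Siegel series (30) of n° 39 evaluated at `ω̃(s_χ(h))Φ` (adv4g4-C12 (a):
  `s_χ|_{H(L₀)} = can`, from [GQT14 §11.2 p. 33] automorphy; [Li92 (18)–(22) p. 183]).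

PLUS Weil's two hypotheses for the datum: condition (B) `2n + 4ε < m + 2` (PerL: `(m,n,4ε) = (3,1,2)`,
`SiegelWeilDatum.example`) and the place/measure hypothesis `placeHyp` (PerL ll. 575–579: any finite `v` of `L₀`
non-split in `L`, `G'_v = G_v`, Witt; = 2001 referee-notes erratum P8).  RESULT (kernel, trio):
`x1_of_weil : W.WeilSiegelWeil → (B) → W.placeHyp → WeilTransport D W → (∃ c > 0, ∀ Φ h, ∫ θ^□ = c · E)`,
i.e. literally the `X1_siegelWeil` field.  Class of the new record `WeilTransport`: DICTIONARY (D4), three fields,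
each with its print anchor; nothing of PerL / [QW8] / [Y1neg] is used; no `def … : Prop` is asserted.
-/

noncomputable section

open MeasureTheory

namespace HodgeCM.PerL34.N31d.SiegelWeilFromWeil

open HodgeCM.Literature.Theta DoublingKernelData

variable (D : DoublingKernelData) (W : SiegelWeilDatum.{0})

/-- **The D4 transport dictionary between pv15's doubling-kernel carriers and Weil's carriers** (three labelled
readings, see the module docstring; GAPS adv4g4-C12, LEMMAS §3 D4). -/
structure WeilTransport where
  /-- `(Φ, h) ↦ ω̃(s_χ(h)) Φ ∈ S(X_A)` (Kudla's splitting; adv4g4-C12 (b)). -/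
  pull : D.Ssq → D.HA → W.SX
  /-- the measure constant `c₀ = μ([G_U])` relating PerL's `dg` to Weil's normalised `ν`. -/
  c₀ : ℝ
  c₀_pos : 0 < c₀
  /-- D4: `∫_{[G_U]} θ^□_Φ(x,h) dμ = c₀ · I_ν(ω̃(s_χ(h))Φ)` (Weil's `I_ν(Φ) = ∫_{G_A/G_k} Σ_ξ Φ(ρ(u)ξ) dν(u)`). -/
  theta_pull : ∀ (Φ : D.Ssq) (h : D.HA), ∫ x, D.θsq Φ x h ∂D.μ = (c₀ : ℂ) * W.thetaInt (pull Φ h)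
  /-- D4: `E(h, s₀; f_Φ) = E(ω̃(s_χ(h))Φ)` (Weil's Eisenstein–Siegel series (30), n° 39; adv4g4-C12 (a)). -/
  eis_pull : ∀ (Φ : D.Ssq) (h : D.HA), D.E Φ h = W.eis (pull Φ h)

variable {D W}

/-- **`X1_siegelWeil` BY NAME from Weil's Théorème 5** ([We65 n° 52] = `SiegelWeilDatum.WeilSiegelWeil`, KHR-8):
given Weil's theorem for the datum `W`, Weil's condition (B), his place/measure hypothesis, and the D4 transport
dictionary, PerL's identity `∫_{[G_U]} θ^□_Φ(g,h) dg = c · E(h, s₀; f_Φ)` holds with `c = c₀ > 0` — the exact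
shape of `PrintInputs.X1_siegelWeil`. -/
theorem x1_of_weil (hW : W.WeilSiegelWeil) (hB : 2 * W.n + W.fourEps < W.m + 2) (hp : W.placeHyp)
    (T : WeilTransport D W) :
    ∃ c : ℝ, 0 < c ∧ ∀ (Φ : D.Ssq) (h : D.HA), ∫ x, D.θsq Φ x h ∂D.μ = (c : ℂ) * D.E Φ h := by
  refine ⟨T.c₀, T.c₀_pos, fun Φ h => ?_⟩
  rw [T.theta_pull Φ h, T.eis_pull Φ h, hW hB hp (T.pull Φ h)]

/-- PerL's numeric instance of Weil's condition (B) for a datum recording `(m, n, 4ε) = (3, 1, 2)`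
(tex l. 574–575; `SiegelWeil.weil_condition_B` is the same arithmetic over `ℚ`). -/
theorem conditionB_of_perL (hm : W.m = 3) (hn : W.n = 1) (he : W.fourEps = 2) :
    2 * W.n + W.fourEps < W.m + 2 := by
  omega

end HodgeCM.PerL34.N31d.SiegelWeilFromWeil

end
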